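import Literature.NumberTheory.Transcendental.KZLogCalculusProofs
import Literature.NumberTheory.Transcendental.KZMellinFibres
import Literature.NumberTheory.Transcendental.KZDominatedFamilyRelations
import Summits.KontsevichZagierPeriods.KontsevichZagierPeriods.Theorems.HurwitzMicroSectorsNormalFormPrincipleLevelOneExistsRep

/-!
# `NormalFormPrinciple` (stmt-KontsevichZagierPeriods-3869), line `SketchIdeator1` — leaf `stub_boxRigidity`,
# dimension two off the product type (`FiveZetaTwoOffProduct`): existence of unfolded log monomials over `(0,1)`

Pure proof file (stub `exists_logMonomialRep`; `--supports` the crux). For `g, v : ℝ → ℝ` such that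
`x ↦ g (x 0)` and `x ↦ v (x 0)` are `ℚ`-semialgebraic on the base `σ = {0 < x 0 < 1} ⊆ ℝ¹`,
`v ≥ 1` on `(0,1)` and `g · log v` absolutely integrable on `(0,1)`, the "log monomial"
`M(g, v) = [{(x, s) | 0 < x < 1, 1 ≤ s ≤ v x}, g(x)/s]` is an integral representation of
dimension `2` in the tree's Kontsevich–Zagier calculus (`KZ.IntegralRep 2`), with domain the band
`KZlog.band σ 1 (v ∘ ·0)` and integrand `z ↦ g (z 0) / z 1` (literal equalities).

Proof: the one-variable integrability hypothesis is transported to `ℝ¹ = (Fin 1 → ℝ)` along the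
measure-preserving equivalence `MeasurableEquiv.funUnique` (as in
`isRealPeriod_intervalIntegral`); this makes `[σ; 0; (g, v)]` an admissible logarithmic term
(`KZlog.Term.Admissible`), and the representation sought is the unfolding
`KZlog.IntegralRep.monomialRep` of its single monomial ("introducing more variables":
`log v = ∫₁^v ds/s`), whose domain and integrand are the required ones by `rfl`.

References: M. Kontsevich, D. Zagier, *Periods* (2001), §1.1–§1.2. No new definitions.
-/

noncomputable section

open MeasureTheory Set
open Literature.NumberTheory.Transcendental Literature.NumberTheory.Transcendental.KZ
open Literature.ModelTheory.ExponentialFields (IsSemialgebraic)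

namespace Summit.KontsevichZagierPeriods.HurwitzMicroSectors.NormalFormPrinciple.PiBox.M2

/-- Transport of integrability from `(0,1) ⊆ ℝ` to the base `σ = {0 < x 0 < 1} ⊆ ℝ¹` along the
measure-preserving equivalence `ℝ¹ ≃ ℝ`. [folklore] -/
theorem integrableOn_fin_one_of_integrableOn_Ioo {f : ℝ → ℝ}
    (hf : IntegrableOn f (Set.Ioo (0:ℝ) 1)) :
    IntegrableOn (fun x : Fin 1 → ℝ => f (x 0)) {x : Fin 1 → ℝ | 0 < x 0 ∧ x 0 < 1} := by
  have hmp := MeasureTheory.volume_preserving_funUnique (Fin 1) ℝ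
  have hpre : {x : Fin 1 → ℝ | 0 < x 0 ∧ x 0 < 1} =
      MeasurableEquiv.funUnique (Fin 1) ℝ ⁻¹' Ioo 0 1 := by
    ext x
    simp [MeasurableEquiv.funUnique, Fin.default_eq_zero]
  rw [hpre]
  exact (hmp.integrableOn_comp_preimage (MeasurableEquiv.measurableEmbedding _)).mpr hf

/-- **Admissibility of the one-monomial logarithmic term `[σ; 0; (g, v)]` over the base
`σ = {0 < x 0 < 1}`**: `σ` is `ℚ`-semialgebraic, `0`, `g`, `v` are `ℚ`-semialgebraic on `σ`,
`v ≥ 1` on `σ`, and `g log v` is absolutely integrable on `σ` (transported from `(0,1)`).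
[Kontsevich–Zagier 2001, §1.1] [folklore] -/
theorem admissible_logTerm (g v : ℝ → ℝ)
    (hg : IsSemialgebraicFunOn ℚ {y : Fin 1 → ℝ | 0 < y 0 ∧ y 0 < 1} (fun y => g (y 0)))
    (hv : IsSemialgebraicFunOn ℚ {y : Fin 1 → ℝ | 0 < y 0 ∧ y 0 < 1} (fun y => v (y 0)))
    (hv1 : ∀ x ∈ Set.Ioo (0:ℝ) 1, 1 ≤ v x)
    (hint : IntegrableOn (fun x => g x * Real.log (v x)) (Set.Ioo (0:ℝ) 1)) :
    KZlog.Term.Admissible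
      ⟨{y : Fin 1 → ℝ | 0 < y 0 ∧ y 0 < 1}, 0, 1, fun _ y => g (y 0), fun _ y => v (y 0)⟩ where
  isSemialgebraic_domain := isSemialgebraic_unitInterval_fin_one
  isSemialgebraicFunOn_h₀ :=
    (isSemialgebraicFunOn_ratCast isSemialgebraic_unitInterval_fin_one 0).congr fun x _ => by simp
  integrableOn_h₀ := integrableOn_zero
  isSemialgebraicFunOn_h := fun _ => hg
  isSemialgebraicFunOn_v := fun _ => hv
  one_le_v := fun _ y hy => hv1 (y 0) hy
  integrableOn_monomial := fun _ =>
    integrableOn_fin_one_of_integrableOn_Ioo (f := fun x => g x * Real.log (v x)) hint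

/-- **Stub E (existence of unfolded log monomials over `(0,1)`).** For `g`, `v` `ℚ`-semialgebraic on
`(0,1)` with `v ≥ 1` and `g log v` absolutely integrable on `(0,1)`, the unfolded monomial
`M(g, v) = [{0 < x < 1, 1 ≤ s ≤ v x}, g(x)/s]` is an integral representation of dimension `2`: the
unfolding `KZlog.IntegralRep.monomialRep` of the admissible term `[σ; 0; (g, v)]`
("introducing more variables", `log v = ∫₁^v ds/s`). [Kontsevich–Zagier 2001, §1.1–§1.2]
[folklore] -/
theorem exists_logMonomialRep (g v : ℝ → ℝ)
    (hg : IsSemialgebraicFunOn ℚ {y : Fin 1 → ℝ | 0 < y 0 ∧ y 0 < 1} (fun y => g (y 0)))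
    (hv : IsSemialgebraicFunOn ℚ {y : Fin 1 → ℝ | 0 < y 0 ∧ y 0 < 1} (fun y => v (y 0)))
    (hv1 : ∀ x ∈ Set.Ioo (0:ℝ) 1, 1 ≤ v x)
    (hint : IntegrableOn (fun x => g x * Real.log (v x)) (Set.Ioo (0:ℝ) 1)) :
    ∃ R : IntegralRep 2,
      R.domain = KZlog.band {y : Fin 1 → ℝ | 0 < y 0 ∧ y 0 < 1} (fun _ => (1:ℝ)) (fun y => v (y 0)) ∧
      R.integrand = fun z => g (z 0) / z 1 :=
  ⟨KZlog.IntegralRep.monomialRep ⟨_, admissible_logTerm g v hg hv hv1 hint⟩ 0, rfl, rfl⟩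

end Summit.KontsevichZagierPeriods.HurwitzMicroSectors.NormalFormPrinciple.PiBox.M2
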